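/-
Copyright (c) 2026 the pub-hodgecm-mathlib formalisation cell (harness21).  Prover seat hodgecm-mathlib-LH4-p10 (g2), req620 Track A «(D-RAM) FOUR-FRAME» squad
(MS ROAD A, Stage B lead; B10₂-MULT PAYER — the type-2 stable count on multiplicity, over the squad's ★ type-2 sockets).  2026-09-04.
-/
import Summits.HodgeConjecture.HodgeConjecture.Theorems.F0P3cDyRamStableCountTypeTwoGeneric       -- ★ (this seat) p856349: the weight-generic B10₂ assembly
import Summits.HodgeConjecture.HodgeConjecture.Theorems.F0P3cDyRamDiagonalStrataShapesTypeTwo    -- ★ B3₂-γ (LH4-p04 (g2)) p856358: `hasAxis_shapes_typeTwo`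
import Summits.HodgeConjecture.HodgeConjecture.Theorems.F0P3cDyRamDiagonalStrataDefs            -- ★ ED. 3 p856283: `polarisationCount`, `polarisationCount_two_eq_zero_of_not_isTypeTwoPolarisable`
import Summits.HodgeConjecture.HodgeConjecture.Theorems.F0P3cDyRamDiagonalSplitCountTwoMult          -- ★ T₂-MULT sockets (LH4-p13 (g2)) p856520
import Summits.HodgeConjecture.HodgeConjecture.Theorems.F0P3cDyRamDiagonalPermutationTwo            -- ★ §P₂ ED. 2 (LH4-p13 (g2)) p856500: `…_G2_of_G1`, `…_G3_of_G1` for the weight n₂·w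
import Summits.HodgeConjecture.HodgeConjecture.Theorems.F0P3cDyRamDiagonalGluedSocketTwoStub        -- ★ G1₂-MULT socket (F0P3-p01 (g31)) p856576; brings ★ GluedSocketTwo p856489 (+ p08∕p09 class counts)
import Summits.HodgeConjecture.HodgeConjecture.Theorems.F0P3cDyRamDiagonalCoreHangingSocketTypeTwo  -- ★ H₂-MULT socket (LH4-p07 (g4)) p856639; brings ★ B7₂ files
import HarnessLib

/-!
# Crux `H413`, MS ROAD A, STAGE B — B10₂ «THE TYPE-2 STABLE COUNT ON MULTIPLICITY»: `Σᶠ_{M ∈ 𝓛₀(T)} n₂(M)∕[𝒰_F : S_F(M)] = (q^k − 1)∕(q − 1)`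

Cell `hodgecm-mathlib` (D-0151), FLOOR 0, crux item H413 = `stmt-HodgeConjecture-24833`, route of record `HCCMUnconditional`; lane `--supports stmt-HodgeConjecture-24833 --as helper`
(count-neutral).  THEOREMS ONLY (no `def`, no instance, no notation, no `sorry`).  This file PAYS the tree U3 ED. 8 stub `stub_U3_stableCount_typeTwo_mult` (= the `hB10₂`
binder of ★ `F0P3cDyRamStableModelSumOfStageB.stableModelSum_of_stageB_mult`) LETTER FOR LETTER: head `finsum_polarisationCount_mul_stabiliserWeight_eq`.

THE MATHEMATICS (LH4-p10 MEMO v2.2 «type-2 half re-keyed on multiplicity»; LH4-p09 (g2) flag 2026-09-04T00:42:58Z, LH4-p11 (g2) ruling 00:53Z).  With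
`n₂(M) = polarisationCount σ ϖ 2 M` = the number of `S_F(M)`-classes of non-degenerate `σ`-fixed diagonal forms of which `M` is a type-2 vertex lattice, the weighted class
count `Σᶠ_{M ∈ 𝓛₀(T)} n₂(M)·stabiliserWeight σ M` equals the `q`-bracket `[k]_q`, `2k + d = n₁ + n₂ + n₃ + 2` — the type-2 twin of ★ B10 `finsum_stabiliserWeight_dualisable_eq`.
(The indicator-weighted statement of skeleton₂ v1 is FALSE: at ℚ₂(√2), key (7,5,5), `Σ n₂·w = 255 = [8]₂` but `Σ w = 239`; the glued stratum `(5,7,7)` has `n₂ = q`.)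
PROOF = ONE APPLICATION of the weight-generic assembly ★ `F0P3cDyRamStableCountTypeTwoGeneric.finsum_mem_normalisedStableLattices_eq_of_typeTwo_table` (this seat, p856349) at
`f := fun M => (polarisationCount σ ϖ 2 M : ℚ) * stabiliserWeight σ M`, fed with: `hf0` ★ ED. 3 `polarisationCount_two_eq_zero_of_not_isTypeTwoPolarisable` (LH4-p11 (g2)); the
B3₂-γ shape list ★ `hasAxis_shapes_typeTwo` (LH4-p04 (g2)); the on-branch sockets ★ `finsum_polarisationCount_mul_stabiliserWeight_stratumTwo_T1∕T2∕T3` (LH4-p13 (g2)); the glued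
socket ★ `…GluedSocketTwoStub.finsum_polarisationCount_mul_stabiliserWeight_stratumTwo_G1` (F0P3-p01 (g31) over LH4-p08∕LH4-p09's class counts) and its permuted copies by ★ §P₂
`…stratumTwo_G2_of_G1 ∕ …_G3_of_G1` (LH4-p13 (g2); `min_comm` + one `by_cases n₁ = n₂` for G₃); the core-hanging socket ★
`…CoreHangingSocketTypeTwo.finsum_polarisationCount_mul_stabiliserWeight_hasAxis_H` (LH4-p07 (g4)).
* `finsum_polarisationCount_mul_stabiliserWeight_eq` — HEAD (B10₂-MULT).
HONEST LABEL.  Count-neutral; `HC_CM` is proved only modulo the 7 printed citations (2 remaining named inputs: hLiu418 = `stmt-HodgeConjecture-24832`, h413 = `stmt-HodgeConjecture-24833`) until rung 0 closes.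

## References
* [Kottwitz1986BaseChangeUnits] R. Kottwitz, *Base change for unit elements of Hecke algebras*, Compositio Math. 60 (1986), §1 pp. 240–241 (counting fixed lattices by position).
* [Rogawski1990] J. Rogawski, *Automorphic representations of unitary groups in three variables*, Ann. of Math. Stud. 123 (1990), §4.9 Prop. 4.9.1 (a) p. 55 (the stable count).
-/

set_option autoImplicit false

noncomputable section

namespace Summit.HodgeConjecture.HodgeConjecture.Cruxes.H413.F0P3cDyRamStableCountTypeTwo

open Literature.NumberTheory.Automorphic Literature.NumberTheory.Automorphic.HermitianLattice
open Literature.NumberTheory.Automorphic.UnitaryLatticeTree Literature.NumberTheory.Automorphic.UnitaryThreeFourFrame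
open Summit.HodgeConjecture.HodgeConjecture.Cruxes.H413.F0P3cDyRamDiagonalTorusDefs
open Summit.HodgeConjecture.HodgeConjecture.Cruxes.H413.F0P3cDyRamDiagonalStrataDefs
open Summit.HodgeConjecture.HodgeConjecture.Cruxes.H413.F0P3cDyRamStableCountTypeTwoGeneric (finsum_mem_normalisedStableLattices_eq_of_typeTwo_table)
open Summit.HodgeConjecture.HodgeConjecture.Cruxes.H413.F0P3cDyRamDiagonalStrataShapesTypeTwo (hasAxis_shapes_typeTwo)
open Summit.HodgeConjecture.HodgeConjecture.Cruxes.H413.F0P3cDyRamDiagonalSplitCountTwoMult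
open Summit.HodgeConjecture.HodgeConjecture.Cruxes.H413.F0P3cDyRamDiagonalPermutationTwo
open Summit.HodgeConjecture.HodgeConjecture.Cruxes.H413.F0P3cDyRamDiagonalGluedSocketTwoStub (finsum_polarisationCount_mul_stabiliserWeight_stratumTwo_G1)
open Summit.HodgeConjecture.HodgeConjecture.Cruxes.H413.F0P3cDyRamDiagonalCoreHangingSocketTypeTwo (finsum_polarisationCount_mul_stabiliserWeight_hasAxis_H)
open scoped Valued WithZero Matrix MatrixGroups

variable {K : Type} [Field K] [Valued K ℤᵐ⁰]

/-- **B10₂-MULT · THE TYPE-2 STABLE COUNT ON MULTIPLICITY** (the `hB10₂` binder of LH4-p11 (g2)'s `stableModelSum_of_stageB_mult`, letters VERBATIM):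
`Σᶠ_{M ∈ 𝓛₀(T)} n₂(M)·1∕[𝒰_F : S_F(M)] = (q^k − 1)∕(q − 1)`, `n₂ = polarisationCount σ ϖ 2`.
[cite: Kottwitz1986BaseChangeUnits, §1 pp. 240–241] [cite: Rogawski1990, §4.9 Prop. 4.9.1 (a) p. 55] -/
theorem finsum_polarisationCount_mul_stabiliserWeight_eq [Fintype 𝓀[K]] {σ : K →+* K} {ϖ : K} {d t : ℕ} (hD : IsRamifiedQuadraticDatum σ ϖ d t)
    (h2 : Valued.v (2 : K) < 1) {α β : K} {N₀ n₁ n₂ n₃ : ℕ} (hE : IsElementDatum σ ϖ N₀ α β n₁ n₂ n₃) (hN₀ : d ≤ N₀)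
    (T : GL (Fin 3) K) (hT : (T : Matrix (Fin 3) (Fin 3) K) = Matrix.diagonal ![α, β, 1]) (k : ℕ) (hk : 2 * k + d = n₁ + n₂ + n₃ + 2) :
    ∑ᶠ M ∈ normalisedStableLattices T, (polarisationCount σ ϖ 2 M : ℚ) * stabiliserWeight σ M =
      ((Fintype.card 𝓀[K] : ℚ) ^ k - 1) / ((Fintype.card 𝓀[K] : ℚ) - 1) :=
  finsum_mem_normalisedStableLattices_eq_of_typeTwo_table hD hE hN₀ T hT k hk (fun M => (polarisationCount σ ϖ 2 M : ℚ) * stabiliserWeight σ M)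
    (fun M _ hM => by rw [polarisationCount_two_eq_zero_of_not_isTypeTwoPolarisable σ ϖ M hM, Nat.cast_zero, zero_mul])
    (fun hM hpol ha => hasAxis_shapes_typeTwo hD hM hpol ha)
    (fun s hs => finsum_polarisationCount_mul_stabiliserWeight_stratumTwo_T1 hD hE hT s hs)
    (fun s hs => finsum_polarisationCount_mul_stabiliserWeight_stratumTwo_T2 hD hE hT s hs)
    (fun s hs => finsum_polarisationCount_mul_stabiliserWeight_stratumTwo_T3 hD hE hT s hs)
    (fun ρ s hs => finsum_polarisationCount_mul_stabiliserWeight_stratumTwo_G1 hD h2 hE hN₀ hT ρ s hs)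
    (fun ρ s hs => finsum_polarisationCount_mul_stabiliserWeight_stratumTwo_G2_of_G1 hE hT (2 * ρ + 1) s
      (fun m₁ m₂ m₃ => (if 2 ∣ s ∧ 2 * ρ + 1 ≤ min m₂ m₃ ∧ 2 * ρ + 1 + s ≤ m₁ then (((Fintype.card 𝓀[K] : ℚ) - 1) * (Fintype.card 𝓀[K] : ℚ) ^ (2 * ρ + s / 2)) else 0) +
        (if 2 ∣ s ∧ m₂ = m₃ ∧ m₁ = m₂ + s ∧ m₂ < 2 * ρ + 1 ∧ 2 * ρ + 1 ≤ 2 * m₂ ∧ 2 * ρ + 1 - m₂ ≤ m₂ - d + 1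
          then ((Fintype.card 𝓀[K] : ℚ) ^ (2 * ρ + 1 + s / 2 - (2 * ρ + 1 - m₂ + 1) / 2)) else 0))
      (fun T' hE' hT' => finsum_polarisationCount_mul_stabiliserWeight_stratumTwo_G1 hD h2 hE' hN₀ hT' ρ s hs))
    (fun ρ s hs => by
      have h := finsum_polarisationCount_mul_stabiliserWeight_stratumTwo_G3_of_G1 hD.2.1 hE hT (2 * ρ + 1) s
        (fun m₁ m₂ m₃ => (if 2 ∣ s ∧ 2 * ρ + 1 ≤ min m₂ m₃ ∧ 2 * ρ + 1 + s ≤ m₁ then (((Fintype.card 𝓀[K] : ℚ) - 1) * (Fintype.card 𝓀[K] : ℚ) ^ (2 * ρ + s / 2)) else 0) +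
          (if 2 ∣ s ∧ m₂ = m₃ ∧ m₁ = m₂ + s ∧ m₂ < 2 * ρ + 1 ∧ 2 * ρ + 1 ≤ 2 * m₂ ∧ 2 * ρ + 1 - m₂ ≤ m₂ - d + 1
            then ((Fintype.card 𝓀[K] : ℚ) ^ (2 * ρ + 1 + s / 2 - (2 * ρ + 1 - m₂ + 1) / 2)) else 0))
        (fun T' hE' hT' => finsum_polarisationCount_mul_stabiliserWeight_stratumTwo_G1 hD h2 hE' hN₀ hT' ρ s hs)
      rw [h, min_comm n₂ n₁]
      congr 1
      by_cases h12 : n₁ = n₂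
      · subst h12
        simp only [true_and]
      · rw [if_neg (fun hc => h12 hc.2.1.symm), if_neg (fun hc => h12 hc.2.1)])
    (fun ρ => finsum_polarisationCount_mul_stabiliserWeight_hasAxis_H hD h2 hE hN₀ hT ρ)

end Summit.HodgeConjecture.HodgeConjecture.Cruxes.H413.F0P3cDyRamStableCountTypeTwo

end
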